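import Literature.AlgebraicGeometry.Motives.MumfordTateRankOfCMType
import Literature.AlgebraicGeometry.Motives.HodgeThetaSubalgebraRealPlacesSl2
import HarnessLib

/-!
# Θ-rigidity of a NONDEGENERATE CM torus: a rational subspace `𝔤 ⊆ End_ℚ K` commuting with `K` whose complex span contains the Hodge operator `Θ_Φ` of `V¹_{(K,Φ)}` contains over `ℂ` every odd diagonal operator — in particular `(u · –)_ℂ` for every purely imaginary `u ∈ K` (Deligne 1982 I Ex. 3.7 (c) «`Y(G)` is the Galois module generated by `μ`»; Kubota ∕ Dodson: nondegenerate = `Rank(Φ) = n + 1`)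

Family `hodge`, layer `Literature/AlgebraicGeometry/Motives` (the model Hodge structure `V¹_{(K,Φ)} = ofCMType Φ` on
`V = K`; no geometry).  Cell `pub-hodgeav-hg6` (TABLE X row 22 `Y₃ × Z₃(CM)`: the FACTOR input `hLie₂` of the
product brick, for the CM factor; nothing here proves HC, HC_AV or HC_CM).  UNCONDITIONAL; theorems only, no
definition, no named fact, no instance, no `sorry`.

THE STATEMENT (§3, `CMTorusTheta.diagEnd_mem_spanC_of_theta_mem`).  `K` a CM field, `Φ` a CM type of `K` that is
NONDEGENERATE in the sense of Kubota–Dodson (`Pohlmann1968.IsNondegenerate Φ`: the span of the Galois translates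
`𝟙_{gΦ}` has rank `[K:ℚ]/2 + 1`).  Let `𝔤 ⊆ End_ℚ K` be ANY rational subspace whose elements commute with the
multiplications `(k · –)`, `k ∈ K`, and whose complex span `spanC 𝔤` contains an operator `Θ` acting by
`2p − 1` on `V^{p,1−p}` of `V¹_{(K,Φ)}` (the infinitesimal Hodge operator).  Then `spanC 𝔤` contains
`diag(w)` (in the eigen-basis `e_σ` of `V_ℂ = ℂ ⊗ K`) for EVERY odd vector `w : Hom(K,ℂ) → ℂ`, `w(σ̄) = −w(σ)`:
that is, the whole complexified Lie algebra `𝔲_K ⊗ ℂ = (K⁻)_ℂ` of the compact torus `U_K`; in particular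
`(u · –)_ℂ ∈ spanC 𝔤` for every `u ∈ K` with `ū = −u` (`CMTorusTheta.lmul_baseChange_mem_spanC_of_theta_mem`)
and, by descent, `(u · –) ∈ 𝔤` (`CMTorusTheta.lmul_mem_of_theta_mem`).  No bracket-closedness and no
polarization is needed.  For `𝔤 = Lie Hg(V¹_{(K,Φ)})` this is «`Hg = U_K` for a nondegenerate type» in Lie form
(`CMTorusTheta.lmul_baseChange_mem_hodgeLieC_of_isNondegenerate`); the point of the hull form is that it is
Θ-RIGIDITY: every admissible Lie algebra through `Θ` already contains the torus (the shape in which the product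
bricks of the tree — `HodgeLieProductSimpleFactor.hodgeLie_eq_map_restrict_of_rigid`,
`HodgeThetaSubalgebraUnitary*` — consume factor inputs).

THE PROOF (Deligne's (c) run for an arbitrary `𝔤`): §1 for a nondegenerate `Φ` the translates of the `±1`-vector
`θ_Φ = 2·𝟙_Φ − 1` span the whole ODD part of `ℂ^{Hom(K,ℂ)}` (dimension count against `Rank(Φ) = [K:ℚ]/2 + 1`,
the tree's `finrank_span_ratCast_translateInd`); §2 a `ℂ`-span of `Aut(ℂ)`-fixed vectors is twist-stable (the
private lemma of `MumfordTateRankOfCMFamily`, copied); §3 `𝔤 ⊆ {(u · –)}`, `spanC 𝔤 = diag(N)` with `N`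
twist-stable and `N ∋ θ_Φ` (`Θ = diag θ_Φ`, `diagEnd_injective`), so `N ⊇` all `θ_{gΦ}` `⊇` the odd part.

## References
* [Deligne1982HodgeCycles] P. Deligne, *Hodge cycles on abelian varieties*, LNM 900 (1982), I Ex. 3.7 (b)–(c)
  («`Y(G)` is the `Gal(ℚ̄/ℚ)`-module generated by `μ`»), I §3 proof of Prop. 3.4 (rational structures).
* [Dodson1987] B. Dodson, J. Algebra 111 (1987), §1.1 pp. 50–51 (`Rank(Φ)`; «nondegenerate when `Rank(Φ) = n + 1`»).
* [Kubota1965] T. Kubota, Trans. AMS 118 (1965), §2 (rank of a CM type).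
* [MoonenZarhin1999LowDim] B. Moonen, Yu. Zarhin, Math. Ann. 315 (1999), §2 (2.1)–(2.3) (`Hg(X) ⊆ U_F`, equality
  iff no exceptional classes on powers), §3 (3.1).
* [Gordon1999HodgeAVSurvey] B. B. Gordon, arXiv:alg-geom/9709030, 2.12–2.13 (nondegenerate CM types).
-/

noncomputable section

open scoped TensorProduct Pointwise
open Module NumberField

namespace Literature.AlgebraicGeometry.Motives

namespace HodgeStructure

open RealMult (embCoords embCoords_tmul)
open Literature.NumberTheory.ComplexMultiplication
open Literature.AlgebraicGeometry.Pohlmann1968 (cmTypeRank IsNondegenerate isNondegenerate_iff cmTypeRank_le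
  conj_smul_eq_conjugate isCMTypeWith_conj)

variable {K : Type} [Field K] [NumberField K]

/-! ### §1 For a nondegenerate type the translates of `θ_Φ = 2·𝟙_Φ − 1` span the odd part of `ℂ^{Hom(K,ℂ)}` -/

section Combinatorics

variable [IsCMField K] (Φ : CMType K)

/-- `g ∈ Aut(ℂ)` commutes with complex conjugation on the embeddings of a CM field: `g ∘ σ̄ = (g ∘ σ)‾`
(Shimura §18.2 Lemma (i); the tree's `isCMTypeWith_conj`). [cite: Dodson1987, §1.1 (p. 50)] -/
theorem CMTorusTheta.smul_conjugate (g : ℂ ≃+* ℂ) (σ : K →+* ℂ) :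
    g • ComplexEmbedding.conjugate σ = ComplexEmbedding.conjugate (g • σ) := by
  refine RingHom.ext fun x => ?_
  rw [ringEquiv_smul_apply, ComplexEmbedding.conjugate_coe_eq, ComplexEmbedding.conjugate_coe_eq,
    ← IsCMField.complexEmbedding_complexConj K σ x, ← ringEquiv_smul_apply g σ (IsCMField.complexConj K x),
    IsCMField.complexEmbedding_complexConj K (g • σ) x]

/-- **Each translate `θ_{gΦ} = 2·𝟙_{g⁻¹Φ} − 1` is ODD**: `θ(σ̄) = −θ(σ)` (a translate of a CM type is a CM type).
[cite: Dodson1987, §1.1 (p. 50)] -/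
theorem CMTorusTheta.translate_theta_conjugate (g : ℂ ≃+* ℂ) (σ : K →+* ℂ) :
    (2 * ((translateInd Φ.1 g (ComplexEmbedding.conjugate σ) : ℚ) : ℂ) - 1) =
      -(2 * ((translateInd Φ.1 g σ : ℚ) : ℂ) - 1) := by
  have hc : g • ComplexEmbedding.conjugate σ = ComplexEmbedding.conjugate (g • σ) :=
    CMTorusTheta.smul_conjugate g σ
  by_cases hm : g • σ ∈ Φ.1
  · have hn : g • ComplexEmbedding.conjugate σ ∉ Φ.1 := by rw [hc]; exact (Φ.2 (g • σ)).1 hm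
    rw [translateInd_of_mem hm, translateInd_of_not_mem hn]
    push_cast
    ring
  · have hy : g • ComplexEmbedding.conjugate σ ∈ Φ.1 := by
      rw [hc]
      by_contra hn
      exact hm ((Φ.2 (g • σ)).2 hn)
    rw [translateInd_of_not_mem hm, translateInd_of_mem hy]
    push_cast
    ring

/-- **For a NONDEGENERATE CM type the `ℂ`-span of the translates `θ_{gΦ}` (`g ∈ Aut(ℂ)`) is the whole odd part
`{w : w(σ̄) = −w(σ)}` of `ℂ^{Hom(K,ℂ)}`.**  The span `T` lies in the odd part `O`; `O` injects into `ℂ^Φ` by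
restriction, so `dim O ≤ |Φ| = [K:ℚ]/2`; and `𝟙_{gΦ} = (θ_{gΦ} + 𝟙)/2` puts the span of the indicators (dimension
`Rank(Φ)`, `finrank_span_ratCast_translateInd`) inside `T + ℂ·𝟙`, so `Rank(Φ) ≤ dim T + 1`; nondegeneracy
`Rank(Φ) = [K:ℚ]/2 + 1` forces `T = O`.  (Deligne I Ex. 3.7 (c) with (2.1) of Moonen–Zarhin: `Lie U_K = K⁻` has
dimension `[K:ℚ]/2`.) [cite: Deligne1982HodgeCycles, I Ex. 3.7 (c)] [cite: Dodson1987, §1.1 (pp. 50–51)]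
[cite: MoonenZarhin1999LowDim, §2 (2.1)] -/
theorem CMTorusTheta.mem_span_translates_theta_of_odd (hnd : IsNondegenerate Φ) {w : (K →+* ℂ) → ℂ}
    (hw : ∀ σ, w (ComplexEmbedding.conjugate σ) = -w σ) :
    w ∈ Submodule.span ℂ (Set.range fun g : ℂ ≃+* ℂ =>
      fun σ : K →+* ℂ => (2 * ((translateInd Φ.1 g σ : ℚ) : ℂ) - 1)) := by
  classical
  set T : Submodule ℂ ((K →+* ℂ) → ℂ) := Submodule.span ℂ (Set.range fun g : ℂ ≃+* ℂ =>
    fun σ : K →+* ℂ => (2 * ((translateInd Φ.1 g σ : ℚ) : ℂ) - 1)) with hT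
  -- the odd part as the kernel of `v ↦ (σ ↦ v σ̄ + v σ)`
  set L : ((K →+* ℂ) → ℂ) →ₗ[ℂ] ((K →+* ℂ) → ℂ) :=
    LinearMap.funLeft ℂ ℂ (ComplexEmbedding.conjugate : (K →+* ℂ) → (K →+* ℂ)) + LinearMap.id with hL
  have hLapply : ∀ v σ, L v σ = v (ComplexEmbedding.conjugate σ) + v σ := fun v σ => rfl
  set O : Submodule ℂ ((K →+* ℂ) → ℂ) := LinearMap.ker L with hO
  have hmemO : ∀ v : (K →+* ℂ) → ℂ, v ∈ O ↔ ∀ σ, v (ComplexEmbedding.conjugate σ) = -v σ := by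
    intro v
    rw [hO, LinearMap.mem_ker]
    constructor
    · intro h σ
      have hσ := congr_fun h σ
      rw [hLapply, Pi.zero_apply] at hσ
      exact eq_neg_of_add_eq_zero_left hσ
    · intro h
      funext σ
      rw [hLapply, h σ, Pi.zero_apply, neg_add_cancel]
  -- `T ≤ O`
  have hTO : T ≤ O := by
    rw [hT, Submodule.span_le]
    rintro _ ⟨g, rfl⟩
    exact (hmemO _).2 fun σ => CMTorusTheta.translate_theta_conjugate Φ g σ
  -- `dim O ≤ |Φ| = [K:ℚ]/2`: restriction to `Φ` is injective on odd vectors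
  set R : O →ₗ[ℂ] (Φ.1 → ℂ) :=
    (LinearMap.funLeft ℂ ℂ (Subtype.val : Φ.1 → (K →+* ℂ))).comp O.subtype with hR
  have hRinj : Function.Injective R := by
    rw [← LinearMap.ker_eq_bot, LinearMap.ker_eq_bot']
    rintro ⟨v, hv⟩ h0
    have hvO := (hmemO v).1 hv
    have key : ∀ τ ∈ Φ.1, v τ = 0 := fun τ hτ => congr_fun h0 ⟨τ, hτ⟩
    apply Subtype.ext
    funext σ
    change v σ = 0
    by_cases hσ : σ ∈ Φ.1
    · exact key σ hσ
    · have hc : ComplexEmbedding.conjugate σ ∈ Φ.1 := by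
        by_contra hn
        exact hσ ((Φ.2 σ).2 hn)
      have h1 := hvO σ
      rw [key _ hc] at h1
      exact neg_eq_zero.1 h1.symm
  have hcard : Fintype.card ↥Φ.1 = Module.finrank ℚ K / 2 := by
    have h2 := two_mul_ncard_cmType_eq_finrank Φ
    rw [← Nat.card_eq_fintype_card, Nat.card_coe_set_eq]
    omega
  have hOle : Module.finrank ℂ O ≤ Module.finrank ℚ K / 2 := by
    have h := LinearMap.finrank_le_finrank_of_injective hRinj
    rwa [Module.finrank_fintype_fun_eq_card, hcard] at h
  -- `Rank(Φ) ≤ dim T + 1`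
  set Rsp : Submodule ℂ ((K →+* ℂ) → ℂ) := Submodule.span ℂ (Set.range fun g : ℂ ≃+* ℂ =>
    fun σ : K →+* ℂ => ((translateInd Φ.1 g σ : ℚ) : ℂ)) with hRsp
  have hRsp_rank : Module.finrank ℂ Rsp = cmTypeRank Φ := finrank_span_ratCast_translateInd Φ
  have hle : Rsp ≤ T ⊔ Submodule.span ℂ {(1 : (K →+* ℂ) → ℂ)} := by
    rw [hRsp, Submodule.span_le]
    rintro _ ⟨g, rfl⟩
    have hθ : (fun σ : K →+* ℂ => (2 * ((translateInd Φ.1 g σ : ℚ) : ℂ) - 1)) ∈ T :=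
      Submodule.subset_span ⟨g, rfl⟩
    have h1 : (1 : (K →+* ℂ) → ℂ) ∈ Submodule.span ℂ {(1 : (K →+* ℂ) → ℂ)} :=
      Submodule.subset_span rfl
    have heq : (fun σ : K →+* ℂ => ((translateInd Φ.1 g σ : ℚ) : ℂ)) =
        (1 / 2 : ℂ) • (fun σ : K →+* ℂ => (2 * ((translateInd Φ.1 g σ : ℚ) : ℂ) - 1)) +
          (1 / 2 : ℂ) • (1 : (K →+* ℂ) → ℂ) := by
      funext σ
      simp only [Pi.add_apply, Pi.smul_apply, Pi.one_apply, smul_eq_mul]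
      ring
    change (fun σ : K →+* ℂ => ((translateInd Φ.1 g σ : ℚ) : ℂ)) ∈ T ⊔ Submodule.span ℂ {(1 : (K →+* ℂ) → ℂ)}
    rw [heq]
    exact Submodule.add_mem _ (Submodule.mem_sup_left (Submodule.smul_mem _ _ hθ))
      (Submodule.mem_sup_right (Submodule.smul_mem _ _ h1))
  have hone : Module.finrank ℂ (Submodule.span ℂ {(1 : (K →+* ℂ) → ℂ)}) ≤ 1 :=
    (finrank_span_le_card ({(1 : (K →+* ℂ) → ℂ)} : Set ((K →+* ℂ) → ℂ))).trans (by simp)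
  have hT1 : cmTypeRank Φ ≤ Module.finrank ℂ T + 1 := by
    rw [← hRsp_rank]
    exact (Submodule.finrank_mono hle).trans
      ((Submodule.finrank_add_le_finrank_add_finrank _ _).trans (by omega))
  -- nondegeneracy: `Rank(Φ) = [K:ℚ]/2 + 1`, so `dim O ≤ dim T` and `T = O`
  have hrank : cmTypeRank Φ = Module.finrank ℚ K / 2 + 1 := (isNondegenerate_iff Φ).1 hnd
  have hOT : Module.finrank ℂ O ≤ Module.finrank ℂ T := by omega
  have hTeq : T = O := Submodule.eq_of_le_of_finrank_le hTO hOT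
  have hwO : w ∈ O := (hmemO w).2 hw
  rw [← hTeq] at hwO
  exact hwO

end Combinatorics

/-! ### §2 Galois stability: a `ℂ`-span of `Aut(ℂ)`-fixed vectors of `ℂ^S` is stable under `T ↦ g ∘ T ∘ g⁻¹` -/

/-- A `ℂ`-span of vectors `T ∈ ℂ^S` fixed by the semilinear action `T ↦ g ∘ T ∘ g⁻¹` of `Aut(ℂ)` (a subspace
«defined over `ℚ`») is stable under that action (Galois descent, the trivial direction; the private lemma of the
tree's `MumfordTateRankOfCMFamily`). [cite: Deligne1982HodgeCycles, I §3 (proof of Prop. 3.4)] -/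
private theorem twist_mem_span_of_forall_eq' {S : Type*} [MulAction (ℂ ≃+* ℂ) S] {s : Set (S → ℂ)}
    (hs : ∀ T ∈ s, ∀ (g : ℂ ≃+* ℂ) (x : S), g (T (g⁻¹ • x)) = T x) (g : ℂ ≃+* ℂ) {T : S → ℂ}
    (hT : T ∈ Submodule.span ℂ s) : (fun x => g (T (g⁻¹ • x))) ∈ Submodule.span ℂ s := by
  induction hT using Submodule.span_induction with
  | mem T hT =>
    have h : (fun x => g (T (g⁻¹ • x))) = T := funext (hs T hT g)
    rw [h]
    exact Submodule.subset_span hT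
  | zero =>
    have h0 : (fun x => g ((0 : S → ℂ) (g⁻¹ • x))) = 0 := funext fun x => by simp
    rw [h0]
    exact Submodule.zero_mem _
  | add T T' _ _ h h' =>
    have hadd : (fun x => g ((T + T') (g⁻¹ • x))) =
        (fun x => g (T (g⁻¹ • x))) + fun x => g (T' (g⁻¹ • x)) := by
      funext x
      simp only [Pi.add_apply, map_add]
    rw [hadd]
    exact Submodule.add_mem _ h h'
  | smul c T _ h =>
    have hsmul : (fun x => g ((c • T) (g⁻¹ • x))) = g c • fun x => g (T (g⁻¹ • x)) := by
      funext x
      simp only [Pi.smul_apply, smul_eq_mul, map_mul]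
    rw [hsmul]
    exact Submodule.smul_mem _ _ h

/-! ### §3 Θ-rigidity of the nondegenerate CM torus: every rational `𝔤 ∋_ℂ Θ_Φ` commuting with `K` contains `(K⁻)_ℂ` -/

section Rigidity

variable (Φ : CMType K)

open scoped Classical in
/-- **The Hodge operator of `V¹_{(K,Φ)}` is diagonal in the eigen-basis: `Θ = diag(θ_Φ)`, `θ_Φ(σ) = +1` on `Φ`
(`V^{1,0} = ⊕_{σ ∈ Φ} ℂ_σ`), `−1` off `Φ` (`V^{0,1} = ⊕_{σ ∉ Φ} ℂ_σ`).** [cite: Deligne1982HodgeCycles, I Ex. 3.7 (b)]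
[cite: GreenGriffithsKerr2012, §V.B] -/
theorem CMTorusTheta.theta_eq_diagEnd {Θ : Module.End ℂ (ℂ ⊗[ℚ] K)}
    (hΘ : ∀ p : ℤ, ∀ x ∈ (ofCMType Φ).piece p (1 - p), Θ x = ((2 * p - 1 : ℤ) : ℂ) • x) :
    Θ = diagEnd K (fun σ => if σ ∈ Φ.1 then (1 : ℂ) else -1) := by
  refine (cmBasis K).ext fun σ => ?_
  rw [diagEnd_apply_cmBasis]
  by_cases hσ : σ ∈ Φ.1
  · have hmem : cmBasis K σ ∈ (ofCMType Φ).piece 1 (1 - 1) := by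
      rw [show (1 : ℤ) - 1 = 0 by norm_num, piece_one_zero_ofCMType, coordSubspace_eq_span]
      exact Submodule.subset_span ⟨σ, hσ, rfl⟩
    rw [hΘ 1 _ hmem, if_pos hσ]
    norm_num
  · have hmem : cmBasis K σ ∈ (ofCMType Φ).piece 0 (1 - 0) := by
      rw [show (1 : ℤ) - 0 = 1 by norm_num, piece_zero_one_ofCMType, coordSubspace_eq_span]
      exact Submodule.subset_span ⟨σ, hσ, rfl⟩
    rw [hΘ 0 _ hmem, if_neg hσ]
    norm_num


/-- An endomorphism of the `ℚ`-space `K` commuting with every multiplication `(k · –)` IS a multiplication,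
by `X(1)` («`E` is its own commutant», Deligne I Ex. 3.7). [cite: Deligne1982HodgeCycles, I Ex. 3.7] -/
theorem CMTorusTheta.eq_lmul_of_forall_commute {X : Module.End ℚ K}
    (hcomm : ∀ k : K, X * (Algebra.lmul ℚ K k : Module.End ℚ K) = (Algebra.lmul ℚ K k : Module.End ℚ K) * X) :
    X = Algebra.lmul ℚ K (X 1) := by
  refine LinearMap.ext fun v => ?_
  have h := LinearMap.congr_fun (hcomm v) 1
  change X (v * 1) = v * X 1 at h
  rw [mul_one] at h
  rw [h]
  change v * X 1 = X 1 * v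
  exact mul_comm _ _

/-- **`spanC 𝔤 = diag(⟨eigenvalue vectors⟩_ℂ)`** for a rational `𝔤 ⊆ End_ℚ K` commuting with `K`: the complex
span of `𝔤` is the image under `w ↦ diag(w)` of the `ℂ`-span of the vectors `(σ(X 1))_σ`, `X ∈ 𝔤`
(`(u · –)_ℂ = diag((σ u)_σ)`). [cite: Deligne1982HodgeCycles, I Ex. 3.7] -/
theorem CMTorusTheta.spanC_eq_map_diagEnd (𝔤 : Submodule ℚ (Module.End ℚ K))
    (hcomm : ∀ X ∈ 𝔤, ∀ k : K,
      X * (Algebra.lmul ℚ K k : Module.End ℚ K) = (Algebra.lmul ℚ K k : Module.End ℚ K) * X) :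
    spanC 𝔤 = (Submodule.span ℂ ((fun X : Module.End ℚ K => fun σ : K →+* ℂ => σ (X 1)) ''
      (𝔤 : Set (Module.End ℚ K)))).map (diagEnd K) := by
  have hbc : ∀ X ∈ 𝔤, X.baseChange ℂ = diagEnd K (fun σ => σ (X 1)) := fun X hXg => by
    conv_lhs => rw [CMTorusTheta.eq_lmul_of_forall_commute (hcomm X hXg)]
    exact lmul_baseChange_eq_diagEnd (X 1)
  have hset : ((fun X : Module.End ℚ K => X.baseChange ℂ) '' (𝔤 : Set (Module.End ℚ K))) =
      diagEnd K '' ((fun X : Module.End ℚ K => fun σ : K →+* ℂ => σ (X 1)) '' (𝔤 : Set (Module.End ℚ K))) := by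
    ext Y
    constructor
    · rintro ⟨X, hXg, rfl⟩
      exact ⟨_, ⟨X, hXg, rfl⟩, (hbc X hXg).symm⟩
    · rintro ⟨_, ⟨X, hXg, rfl⟩, rfl⟩
      exact ⟨X, hXg, hbc X hXg⟩
  unfold spanC
  rw [hset, Submodule.map_span]

/-- **The eigenvalue vectors of a rational `𝔤` are Galois-fixed, so their span contains every translate
`θ_{gΦ}` once it contains `θ_Φ`**: if `𝔤 ⊆ End_ℚ K` commutes with `K` and `spanC 𝔤 ∋ Θ`, the Hodge operator of
`V¹_{(K,Φ)}`, then `θ_{hΦ} = 2·𝟙_{h⁻¹Φ} − 1` lies in the `ℂ`-span of the vectors `(σ(X 1))_σ`, `X ∈ 𝔤`, for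
every `h ∈ Aut(ℂ)` («`Y(G)` is stable under `Gal(ℚ̄/ℚ)`»). [cite: Deligne1982HodgeCycles, I Ex. 3.7 (c)] -/
theorem CMTorusTheta.translate_theta_mem_span (𝔤 : Submodule ℚ (Module.End ℚ K))
    (hcomm : ∀ X ∈ 𝔤, ∀ k : K,
      X * (Algebra.lmul ℚ K k : Module.End ℚ K) = (Algebra.lmul ℚ K k : Module.End ℚ K) * X)
    {Θ : Module.End ℂ (ℂ ⊗[ℚ] K)}
    (hΘ : ∀ p : ℤ, ∀ x ∈ (ofCMType Φ).piece p (1 - p), Θ x = ((2 * p - 1 : ℤ) : ℂ) • x)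
    (hΘ𝔤 : Θ ∈ spanC 𝔤) (h : ℂ ≃+* ℂ) :
    (fun σ : K →+* ℂ => (2 * ((translateInd Φ.1 h σ : ℚ) : ℂ) - 1)) ∈
      Submodule.span ℂ ((fun X : Module.End ℚ K => fun σ : K →+* ℂ => σ (X 1)) '' (𝔤 : Set (Module.End ℚ K))) := by
  classical
  set s : Set ((K →+* ℂ) → ℂ) :=
    (fun X : Module.End ℚ K => fun σ : K →+* ℂ => σ (X 1)) '' (𝔤 : Set (Module.End ℚ K)) with hs
  -- `s` is fixed by the semilinear twist
  have hsfix : ∀ T ∈ s, ∀ (g : ℂ ≃+* ℂ) (σ : K →+* ℂ), g (T (g⁻¹ • σ)) = T σ := by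
    rintro _ ⟨X, -, rfl⟩ g σ
    change g ((g⁻¹ • σ) (X 1)) = σ (X 1)
    rw [ringEquiv_smul_apply, ← RingAut.mul_apply, mul_inv_cancel, RingAut.one_apply]
  -- `θ_Φ ∈ span s`
  set θ₀ : (K →+* ℂ) → ℂ := fun σ => if σ ∈ Φ.1 then (1 : ℂ) else -1 with hθ₀
  have hΘeq : Θ = diagEnd K θ₀ := CMTorusTheta.theta_eq_diagEnd Φ hΘ
  have hθ₀s : θ₀ ∈ Submodule.span ℂ s := by
    have h1 : Θ ∈ (Submodule.span ℂ s).map (diagEnd K) := by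
      rw [← CMTorusTheta.spanC_eq_map_diagEnd 𝔤 hcomm]
      exact hΘ𝔤
    obtain ⟨T, hT, hTΘ⟩ := Submodule.mem_map.1 h1
    have hTθ : T = θ₀ := diagEnd_injective (hTΘ.trans hΘeq)
    rw [← hTθ]
    exact hT
  -- twist by `h⁻¹`
  have key := twist_mem_span_of_forall_eq' hsfix h⁻¹ hθ₀s
  have hfun : (fun σ : K →+* ℂ => h⁻¹ (θ₀ (h⁻¹⁻¹ • σ))) =
      fun σ : K →+* ℂ => (2 * ((translateInd Φ.1 h σ : ℚ) : ℂ) - 1) := by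
    funext σ
    rw [inv_inv]
    by_cases hm : h • σ ∈ Φ.1
    · rw [hθ₀]
      simp only [if_pos hm, map_one, translateInd_of_mem hm]
      push_cast
      ring
    · rw [hθ₀]
      simp only [if_neg hm, map_neg, map_one, translateInd_of_not_mem hm]
      push_cast
      ring
  rw [hfun] at key
  exact key

variable [IsCMField K]

/-- **Θ-RIGIDITY OF THE NONDEGENERATE CM TORUS (hull form of Deligne I Ex. 3.7 (c)).**  Let `Φ` be a
NONDEGENERATE CM type of the CM field `K` (`Rank(Φ) = [K:ℚ]/2 + 1`), `𝔤 ⊆ End_ℚ K` a rational subspace whose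
elements commute with every multiplication `(k · –)`, `k ∈ K`, and suppose the complex span `spanC 𝔤` contains an
operator `Θ` acting by `2p − 1` on `V^{p,1−p}` of `V¹_{(K,Φ)}`.  Then `diag(w) ∈ spanC 𝔤` for EVERY odd
`w : Hom(K,ℂ) → ℂ` (`w(σ̄) = −w(σ)`): `spanC 𝔤 ⊇ 𝔲_K ⊗ ℂ`.  Proof: `𝔤 ⊆ {(u · –)}` (commutant of `K`), the
eigenvalue vectors `(σ u)_σ` are fixed by `T ↦ g ∘ T ∘ g⁻¹`, so `spanC 𝔤 = diag(N)` with `N` twist-stable (§2);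
`N ∋ θ_Φ` (`Θ = diag θ_Φ`, `diag` injective), hence `N ∋ θ_{gΦ}` for all `g`, hence `N ⊇` odd part (§1).  No
bracket, no polarization, no Hodge-tensor input: the statement holds for every such `𝔤`, which is what makes it a
RIGIDITY statement usable as the factor input `hLie₂` of product bricks.
[cite: Deligne1982HodgeCycles, I Ex. 3.7 (c)] [cite: Dodson1987, §1.1 (pp. 50–51)] [cite: MoonenZarhin1999LowDim, §2 (2.1)–(2.3)] -/
theorem CMTorusTheta.diagEnd_mem_spanC_of_theta_mem (hnd : IsNondegenerate Φ)
    (𝔤 : Submodule ℚ (Module.End ℚ K))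
    (hcomm : ∀ X ∈ 𝔤, ∀ k : K,
      X * (Algebra.lmul ℚ K k : Module.End ℚ K) = (Algebra.lmul ℚ K k : Module.End ℚ K) * X)
    {Θ : Module.End ℂ (ℂ ⊗[ℚ] K)}
    (hΘ : ∀ p : ℤ, ∀ x ∈ (ofCMType Φ).piece p (1 - p), Θ x = ((2 * p - 1 : ℤ) : ℂ) • x)
    (hΘ𝔤 : Θ ∈ spanC 𝔤) {w : (K →+* ℂ) → ℂ} (hw : ∀ σ, w (ComplexEmbedding.conjugate σ) = -w σ) :
    diagEnd K w ∈ spanC 𝔤 := by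
  have hwT := CMTorusTheta.mem_span_translates_theta_of_odd Φ hnd hw
  have hTs : Submodule.span ℂ (Set.range fun g : ℂ ≃+* ℂ =>
      fun σ : K →+* ℂ => (2 * ((translateInd Φ.1 g σ : ℚ) : ℂ) - 1)) ≤
      Submodule.span ℂ ((fun X : Module.End ℚ K => fun σ : K →+* ℂ => σ (X 1)) '' (𝔤 : Set (Module.End ℚ K))) :=
    Submodule.span_le.2 (by
      rintro _ ⟨g, rfl⟩
      exact CMTorusTheta.translate_theta_mem_span Φ 𝔤 hcomm hΘ hΘ𝔤 g)
  rw [CMTorusTheta.spanC_eq_map_diagEnd 𝔤 hcomm]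
  exact Submodule.mem_map_of_mem (hTs hwT)

/-- **Rational reading — the lead's `hLie₂`: `(u · –)_ℂ ∈ spanC 𝔤` for every purely imaginary `u ∈ K`
(`ū = −u`, i.e. `u ∈ K⁻ = Lie U_K`).**  For a NONDEGENERATE CM type every rational subspace `𝔤 ⊆ End_ℚ K`
commuting with `K` whose complex span contains the Hodge operator `Θ` of `V¹_{(K,Φ)}` satisfies
`spanC 𝔤 ⊇ (K⁻ · –)_ℂ` (the eigenvalue vector `(σ u)_σ` of `u ∈ K⁻` is odd: `σ̄(u) = σ(ū) = −σ(u)`).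
[cite: Deligne1982HodgeCycles, I Ex. 3.7 (c)] [cite: MoonenZarhin1999LowDim, §2 (2.1)–(2.3)] -/
theorem CMTorusTheta.lmul_baseChange_mem_spanC_of_theta_mem (hnd : IsNondegenerate Φ)
    (𝔤 : Submodule ℚ (Module.End ℚ K))
    (hcomm : ∀ X ∈ 𝔤, ∀ k : K,
      X * (Algebra.lmul ℚ K k : Module.End ℚ K) = (Algebra.lmul ℚ K k : Module.End ℚ K) * X)
    {Θ : Module.End ℂ (ℂ ⊗[ℚ] K)}
    (hΘ : ∀ p : ℤ, ∀ x ∈ (ofCMType Φ).piece p (1 - p), Θ x = ((2 * p - 1 : ℤ) : ℂ) • x)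
    (hΘ𝔤 : Θ ∈ spanC 𝔤) {u : K} (hu : IsCMField.complexConj K u = -u) :
    (Algebra.lmul ℚ K u : Module.End ℚ K).baseChange ℂ ∈ spanC 𝔤 := by
  rw [lmul_baseChange_eq_diagEnd]
  refine CMTorusTheta.diagEnd_mem_spanC_of_theta_mem Φ hnd 𝔤 hcomm hΘ hΘ𝔤 fun σ => ?_
  rw [ComplexEmbedding.conjugate_coe_eq, ← IsCMField.complexEmbedding_complexConj K σ u, hu, map_neg]

/-- **Descent: `(u · –) ∈ 𝔤` itself** for every purely imaginary `u ∈ K` — a rational subspace `𝔤 ⊆ End_ℚ K`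
commuting with `K` whose complex span contains the Hodge operator of a NONDEGENERATE `V¹_{(K,Φ)}` contains the
whole rational Lie algebra `K⁻ = Lie U_K` (`X ∈ 𝔤 ⟺ X_ℂ ∈ spanC 𝔤`, the tree's `mem_of_baseChange_mem_spanC`).
[cite: Deligne1982HodgeCycles, I Ex. 3.7 (c) and I §3 (proof of Prop. 3.4)] -/
theorem CMTorusTheta.lmul_mem_of_theta_mem (hnd : IsNondegenerate Φ)
    (𝔤 : Submodule ℚ (Module.End ℚ K))
    (hcomm : ∀ X ∈ 𝔤, ∀ k : K,
      X * (Algebra.lmul ℚ K k : Module.End ℚ K) = (Algebra.lmul ℚ K k : Module.End ℚ K) * X)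
    {Θ : Module.End ℂ (ℂ ⊗[ℚ] K)}
    (hΘ : ∀ p : ℤ, ∀ x ∈ (ofCMType Φ).piece p (1 - p), Θ x = ((2 * p - 1 : ℤ) : ℂ) • x)
    (hΘ𝔤 : Θ ∈ spanC 𝔤) {u : K} (hu : IsCMField.complexConj K u = -u) :
    (Algebra.lmul ℚ K u : Module.End ℚ K) ∈ 𝔤 :=
  mem_of_baseChange_mem_spanC 𝔤 (CMTorusTheta.lmul_baseChange_mem_spanC_of_theta_mem Φ hnd 𝔤 hcomm hΘ hΘ𝔤 hu)

/-! ### §4 The instance `𝔤 = Lie Hg(V¹_{(K,Φ)})`: «`Hg = U_K`» for a nondegenerate CM type, Lie form -/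

/-- **`Lie Hg(V¹_{(K,Φ)}) ⊗ ℂ ⊇ 𝔲_K ⊗ ℂ` for a NONDEGENERATE CM type**: every odd diagonal operator lies in the
complexified Hodge Lie algebra of `V¹_{(K,Φ)}` (§3 for `𝔤 = Lie Hg`, which commutes with the Hodge endomorphisms
`(k · –)` and contains the infinitesimal Hodge operator over `ℂ`).  With the tree's
`mtRank_ofCMType_eq_cmTypeRank'` this is the equality `Lie Hg = K⁻` («`dim Hg(A) = dim A`», Gordon 2.13); only the
inclusion that product bricks consume is recorded. [cite: Gordon1999HodgeAVSurvey, 2.12–2.13]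
[cite: MoonenZarhin1999LowDim, §2 (2.1)–(2.3)] [cite: Deligne1982HodgeCycles, I Ex. 3.7 (c)] -/
theorem CMTorusTheta.diagEnd_mem_hodgeLieC_of_isNondegenerate [HodgeTensorFacts.{0, 0}] (hnd : IsNondegenerate Φ)
    {w : (K →+* ℂ) → ℂ} (hw : ∀ σ, w (ComplexEmbedding.conjugate σ) = -w σ) :
    diagEnd K w ∈ (ofCMType Φ).hodgeLieC := by
  obtain ⟨Θ, hΘ⟩ := exists_hodgeTheta (ofCMType Φ)
  have hΘ𝔤 : Θ ∈ spanC (ofCMType Φ).hodgeLie :=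
    (hodgeLieC_eq_spanC (ofCMType Φ)) ▸ (ofCMType Φ).mem_hodgeLieC_of_forall_piece hΘ
  rw [hodgeLieC_eq_spanC]
  exact CMTorusTheta.diagEnd_mem_spanC_of_theta_mem Φ hnd (ofCMType Φ).hodgeLie
    (fun X hX k => (ofCMType Φ).commute_of_mem_hodgeLie hX ⟨Algebra.lmul ℚ K k, lmul_mem_endAlg_ofCMType Φ k⟩)
    hΘ hΘ𝔤 hw

/-- **`(u · –) ∈ Lie Hg(V¹_{(K,Φ)})` for every purely imaginary `u`, `Φ` NONDEGENERATE** — `K⁻ ⊆ Lie Hg` rationally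
(«`Hg(A) = U_K` iff the CM type is nondegenerate», the inclusion `⊇`). [cite: Gordon1999HodgeAVSurvey, 2.12–2.13]
[cite: Deligne1982HodgeCycles, I Ex. 3.7 (c)] -/
theorem CMTorusTheta.lmul_mem_hodgeLie_of_isNondegenerate [HodgeTensorFacts.{0, 0}] (hnd : IsNondegenerate Φ)
    {u : K} (hu : IsCMField.complexConj K u = -u) :
    (Algebra.lmul ℚ K u : Module.End ℚ K) ∈ (ofCMType Φ).hodgeLie := by
  obtain ⟨Θ, hΘ⟩ := exists_hodgeTheta (ofCMType Φ)
  have hΘ𝔤 : Θ ∈ spanC (ofCMType Φ).hodgeLie :=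
    (hodgeLieC_eq_spanC (ofCMType Φ)) ▸ (ofCMType Φ).mem_hodgeLieC_of_forall_piece hΘ
  exact CMTorusTheta.lmul_mem_of_theta_mem Φ hnd (ofCMType Φ).hodgeLie
    (fun X hX k => (ofCMType Φ).commute_of_mem_hodgeLie hX ⟨Algebra.lmul ℚ K k, lmul_mem_endAlg_ofCMType Φ k⟩)
    hΘ hΘ𝔤 hu

end Rigidity

end HodgeStructure

end Literature.AlgebraicGeometry.Motives

end
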